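import Summits.NavierStokesRegularity.NavierStokesRegularity.Theses.TypeICertificateLadder
import Literature.Analysis.FluidPDE.AxisymmetricTypeIAxis
import Literature.Analysis.FluidPDE.SereginSverakPressureProofs
import Literature.Analysis.FluidPDE.NSCriticalClosureBesovKatoClass

/-!
# Route TypeICertificateLadder — crux `NoTypeIBlowup` (item stmt-NavierStokesRegularity-1217):
# reduction of the Clay-class statement to LOCAL Type I regularity

`NoTypeIBlowup` (no Type I blow-up for Clay data: a classical solution of unforced Navier–Stokes
on `ℝ³ × [0, T)`, Leray–Hopf from a rapidly decaying datum, with the rate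
`‖u(t)‖_∞ ≤ C (T − t)^{-1/2}` near `T`, extends smoothly past `T`) is symmetry-free Type I
exclusion — an OPEN problem (Koch–Nadirashvili–Seregin–Šverák 2009, §1; Seregin–Šverák 2009;
Albritton–Barker 2019, Thm. 1.1). This file does not settle it. It PROVES, sorry-free, that the
global Clay-class statement follows from the standard LOCAL statement of the regularity theory,
namely the shape of Seregin–Šverák 2009, Thm. 3.1 (= the catalogued barrier
`Literature.Barriers.NavierStokesRegularity.AxisymmetricTypeIExclusion`) with its axial-symmetry
clause DELETED:

> (local Type I regularity, open) every distributional solution `(v, π)` of the unit-viscosity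
> system in the unit cylinder `Q = 𝒞 × ]-1, 0[` with `v ∈ L³(Q)`, `π ∈ L^{3/2}(Q)` and the a.e.
> rate `√(-s) |v(s, y)| ≤ C` is essentially bounded on some backward parabolic cylinder about
> the vertex `(0, 0)`.

All the Clay-class bookkeeping between the two statements is discharged by theorems of the tree:
Tao's pressure gauge and the `L³` / `L^{3/2}` slab bounds of a classical Leray–Hopf solution
(`SereginSverak2002.isSuitableWeakSolutionOn_gauge_of_classical`,
`SereginSverak2002.lintegral_slab_enorm_pow_three_lt_top`,
`SereginSverak2002.lintegral_slab_gauged_pressure_lt_top`; Tao 2011 Lemma 4.1 (i), Stein's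
`L^{3/2}` bound), the covariance of distributional solutions under the viscosity-normalising
parabolic zoom (`IsDistributionalNSSolutionOn.stRescale`), and Lemarié-Rieusset's Thm. 15.1 (C)
"a finite maximal time carries a singular point"
(`hasSmoothExtensionPast_of_forall_exists_parabolicCylinder`). The zoom is the argument of the
tree's `axisymmetric_typeI_boundedNearTop_axis_of_barrier` (`AxisymmetricTypeIAxis.lean`) with the
axisymmetry block removed and the eventual rate of `IsTypeIBlowup` used on a short final cylinder
(no sub-slab boundedness is needed).

Contents:
* `typeI_exists_bounded_parabolicCylinder_of_local` — under the local hypothesis, every point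
  `(T, x₀)` of the final time of a classical Leray–Hopf solution with the Type I rate carries a
  backward parabolic cylinder on which `u` is essentially bounded;
* `noTypeIBlowup_of_local_typeI_regularity` — the local hypothesis implies the route decl
  `TypeICertificateLadder.NoTypeIBlowup` (item stmt-NavierStokesRegularity-1217, shared with
  routes ThreadingFlux / OddMorawetz / AdaptedFrequency / CoreLogGas / TypeIIInviscidRelaxation).

The theorem is CONDITIONAL on the displayed local statement (an open problem, carried as an
explicit hypothesis, not as a named fact); it does not close the item.
-/

noncomputable section

namespace Summit.NavierStokesRegularity.NavierStokesRegularity.Theorems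

open MeasureTheory Set Function Filter Topology TopologicalSpace Metric
open Literature.Analysis.FluidPDE Literature.Barriers.NavierStokesRegularity
open scoped NNReal ENNReal

/-- **Local Type I regularity gives a bounded backward cylinder at every point of the final
time.** Hypothesis `hloc` (OPEN; Seregin–Šverák 2009, Thm. 3.1 without axial symmetry): every
distributional solution of the unit-viscosity Navier–Stokes system in the unit cylinder
`Q = 𝒞 × ]-1,0[` with `v ∈ L³(Q)`, `π ∈ L^{3/2}(Q)` and the a.e. Type I rate `√(-s)|v| ≤ C` is
essentially bounded on some `Q_r(0, 0)`. Conclusion: for `ν > 0`, `T > 0`, a classical solution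
`(u, p)` on `ℝ³ × [0, T)`, Leray–Hopf on `[0, T)`, with `IsTypeIBlowup u T`, and any `x₀`, the
velocity `u` is essentially bounded on `Q_r(T, x₀)` for some `r > 0`. Proof: gauge the pressure
(`q = p − c(t)`, Tao 2011 Lemma 4.1 (i)), zoom about `(T, x₀)` with `Φ(s, y) = (T + βs, x₀ + Ry)`,
`α = R/ν`, `β = R²/ν`, `R` so small that `Φ(Q)` lies in the final strip where the rate holds; the
rescaled pair solves the unit-viscosity system in `Q`, lies in `L³ × L^{3/2}` by the slab bounds and
the change of variables, and inherits the a.e. rate; `hloc` bounds it near the vertex, and the bound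
is transported back along `Φ`. [cite: SereginSverak2009, Thm 3.1 and §3 (the local statement); Tao2011, Lemma 4.1 (i)] -/
theorem typeI_exists_bounded_parabolicCylinder_of_local
    (hloc : ∀ (v : ℝ → EuclideanSpace ℝ (Fin 3) → EuclideanSpace ℝ (Fin 3))
      (π : ℝ → EuclideanSpace ℝ (Fin 3) → ℝ),
      IsDistributionalNSSolutionOn ssCylinderOpens 1 0 v π →
      (∫⁻ z in ssCylinder, ‖v z.1 z.2‖ₑ ^ (3 : ℕ) < ∞) →
      (∫⁻ z in ssCylinder, ‖π z.1 z.2‖ₑ ^ (3 / 2 : ℝ) < ∞) →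
      (∃ C : ℝ, ∀ᵐ z ∂(volume.restrict ssCylinder), Real.sqrt (-z.1) * ‖v z.1 z.2‖ ≤ C) →
      ∃ r > 0, eLpNorm (uncurry v) ∞ (volume.restrict (parabolicCylinder r ((0 : ℝ), (0 : (EuclideanSpace ℝ (Fin 3)))))) < ∞)
    {ν T : ℝ} (hν : 0 < ν) (hT : 0 < T) {u : ℝ → (EuclideanSpace ℝ (Fin 3)) → (EuclideanSpace ℝ (Fin 3))} {p : ℝ → (EuclideanSpace ℝ (Fin 3)) → ℝ}
    (hcl : IsClassicalNSSolutionOn (Ico 0 T) ν 0 u p) (hLH : IsLerayHopfOn T ν 0 (u 0) u)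
    (hI : IsTypeIBlowup u T) (x₀ : (EuclideanSpace ℝ (Fin 3))) :
    ∃ r > 0, eLpNorm (uncurry u) ∞ (volume.restrict (parabolicCylinder r ((T : ℝ), x₀))) < ∞ := by
  -- the eventual Type I rate on a final strip `(T - δ, T)`
  obtain ⟨C, hC⟩ := hI
  obtain ⟨T₁, hT₁T, hT₁⟩ := mem_nhdsLT_iff_exists_Ioo_subset.1 hC
  set δ : ℝ := min (T - T₁) T with hδ
  have hδpos : 0 < δ := lt_min (sub_pos.2 hT₁T) hT
  have hδT : δ ≤ T := min_le_right _ _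
  have hδT₁ : δ ≤ T - T₁ := min_le_left _ _
  have hrate : ∀ t ∈ Ioo (T - δ) T, ∀ x, Real.sqrt (T - t) * ‖u t x‖ ≤ C := by
    intro t ht x
    have hpos : 0 < Real.sqrt (T - t) := Real.sqrt_pos.2 (sub_pos.2 ht.2)
    have h1 : ‖u t x‖ ≤ C / Real.sqrt (T - t) := hT₁ ⟨by linarith [ht.1], ht.2⟩ x
    calc Real.sqrt (T - t) * ‖u t x‖ ≤ Real.sqrt (T - t) * (C / Real.sqrt (T - t)) :=
          mul_le_mul_of_nonneg_left h1 hpos.le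
      _ = C := mul_div_cancel₀ C hpos.ne'
  -- scales: `ρ² ≤ δ ≤ T`, `R = ρ / κ` with `κ = 2 + 1/√ν`, `α = R/ν`, `β = R²/ν`
  set κ : ℝ := 2 + (Real.sqrt ν)⁻¹ with hκ
  have hκpos : 0 < κ := by positivity
  set ρ : ℝ := Real.sqrt δ / 2 with hρ
  have hρpos : 0 < ρ := by positivity
  have hρδ : ρ ^ 2 ≤ δ := by
    rw [hρ, div_pow, Real.sq_sqrt hδpos.le]; linarith
  have hρT : ρ ^ 2 ≤ T := hρδ.trans hδT
  set R : ℝ := ρ / κ with hR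
  have hRpos : 0 < R := by positivity
  have hρR : ρ = R * κ := by rw [hR]; field_simp
  set α : ℝ := R / ν with hα
  set β : ℝ := R ^ 2 / ν with hβdef
  have hαpos : 0 < α := by positivity
  have hβpos : 0 < β := by positivity
  have hβeq : β = α * R := by rw [hβdef, hα]; field_simp
  have hβρ : β ≤ ρ ^ 2 := by
    have h1 : β = (R * (Real.sqrt ν)⁻¹) ^ 2 := by
      rw [hβdef, mul_pow, inv_pow, Real.sq_sqrt hν.le, div_eq_mul_inv]
    rw [h1, hρR]
    have h2 : (Real.sqrt ν)⁻¹ ≤ κ := by rw [hκ]; linarith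
    have h3 : 0 ≤ (Real.sqrt ν)⁻¹ := by positivity
    exact pow_le_pow_left₀ (by positivity) (mul_le_mul_of_nonneg_left h2 hRpos.le) 2
  have h2Rρ : 2 * R ≤ ρ := by
    rw [hρR, hκ]
    have : 0 ≤ (Real.sqrt ν)⁻¹ := by positivity
    nlinarith
  -- the gauged pressure and the physical cylinder
  set q : ℝ → (EuclideanSpace ℝ (Fin 3)) → ℝ := fun t x => p t x - (p t 0 - normalisedPressure (u t) 0) with hq
  have hsuit : ∀ Q : Opens (ℝ × (EuclideanSpace ℝ (Fin 3))), (Q : Set (ℝ × (EuclideanSpace ℝ (Fin 3)))) ⊆ Ioo 0 T ×ˢ univ →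
      IsSuitableWeakSolutionOn Q ν 0 u q := fun Q hQ =>
    SereginSverak2002.isSuitableWeakSolutionOn_gauge_of_classical hν hT hcl hLH Q hQ
  have hPopen := isOpen_image_stAffine_ssCylinder (T := T) (x₀ := x₀) hβpos.ne' hRpos.ne'
  set PO : Opens (ℝ × (EuclideanSpace ℝ (Fin 3))) := ⟨stAffine β R T x₀ '' ssCylinder, hPopen⟩ with hPO
  have hPcyl : (PO : Set (ℝ × (EuclideanSpace ℝ (Fin 3)))) ⊆ parabolicCylinder ρ ((T : ℝ), x₀) :=
    image_stAffine_ssCylinder_subset hβpos hRpos hβρ h2Rρ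
  have hcylstrip : parabolicCylinder ρ ((T : ℝ), x₀) ⊆ Ioo (T - δ) T ×ˢ (univ : Set (EuclideanSpace ℝ (Fin 3))) := by
    intro z hz
    rw [mem_parabolicCylinder] at hz
    exact ⟨⟨by nlinarith [hz.1.1], hz.1.2⟩, mem_univ _⟩
  have hstripslab : Ioo (T - δ) T ×ˢ (univ : Set (EuclideanSpace ℝ (Fin 3))) ⊆ Ioo 0 T ×ˢ (univ : Set (EuclideanSpace ℝ (Fin 3))) :=
    prod_mono (Ioo_subset_Ioo_left (by linarith)) Subset.rfl
  have hPslab : (PO : Set (ℝ × (EuclideanSpace ℝ (Fin 3)))) ⊆ Ioo 0 T ×ˢ (univ : Set (EuclideanSpace ℝ (Fin 3))) :=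
    hPcyl.trans (hcylstrip.trans hstripslab)
  -- the rescaled pair solves the unit-viscosity system in distributions on the unit cylinder
  have hdist : IsDistributionalNSSolutionOn ssCylinderOpens 1 0 (α • stPull β R T x₀ u)
      (α ^ 2 • stPull β R T x₀ q) := by
    have h0 := ((hsuit PO hPslab).distributional).stRescale hαpos hRpos hβeq T x₀
    have hvisc : α * ν / R = 1 := by
      rw [hα, div_mul_cancel₀ R hν.ne', div_self hRpos.ne']
    have hforce : ((α ^ 2 * R) • stPull β R T x₀ (0 : ℝ → (EuclideanSpace ℝ (Fin 3)) → (EuclideanSpace ℝ (Fin 3)))) = 0 := by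
      funext s y; simp [stPull]
    rw [hvisc, hforce, stPreimage_image_ssCylinder hβpos.ne' hRpos.ne' hPopen] at h0
    exact h0
  -- `v ∈ L³(Q)`
  have hpre : stAffine β R T x₀ ⁻¹' (PO : Set (ℝ × (EuclideanSpace ℝ (Fin 3)))) = ssCylinder :=
    preimage_image_eq _ (injective_stAffine hβpos.ne' hRpos.ne' T x₀)
  have hL3 : ∫⁻ z in ssCylinder, ‖(α • stPull β R T x₀ u) z.1 z.2‖ₑ ^ (3 : ℕ) < ∞ := by
    rw [← hpre, setLIntegral_enorm_pow_stRescale hβpos hRpos T x₀ α u _ 3]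
    refine ENNReal.mul_lt_top
      (ENNReal.mul_lt_top (ENNReal.pow_lt_top enorm_lt_top) ENNReal.ofReal_lt_top) ?_
    exact lt_of_le_of_lt (lintegral_mono_set hPslab)
      (SereginSverak2002.lintegral_slab_enorm_pow_three_lt_top hν hLH)
  -- `π ∈ L^{3/2}(Q)`
  have hL32 : ∫⁻ z in ssCylinder, ‖(α ^ 2 • stPull β R T x₀ q) z.1 z.2‖ₑ ^ (3 / 2 : ℝ) < ∞ := by
    rw [← hpre, setLIntegral_enorm_rpow_stRescale hβpos hRpos T x₀ (α ^ 2) q _ (by norm_num)]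
    refine ENNReal.mul_lt_top (ENNReal.mul_lt_top
      (ENNReal.rpow_lt_top_of_nonneg (by norm_num) enorm_ne_top) ENNReal.ofReal_lt_top) ?_
    exact lt_of_le_of_lt (lintegral_mono_set hPslab)
      (SereginSverak2002.lintegral_slab_gauged_pressure_lt_top hν hT hcl hLH)
  -- the Type I rate in the rescaled time
  have htypeI : ∃ C' : ℝ, ∀ᵐ z ∂(volume.restrict ssCylinder),
      Real.sqrt (-z.1) * ‖(α • stPull β R T x₀ u) z.1 z.2‖ ≤ C' := by
    refine ⟨α / Real.sqrt β * C, (ae_restrict_mem isOpen_ssCylinder.measurableSet).mono ?_⟩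
    intro z hz
    obtain ⟨hs, -, -⟩ := mem_ssCylinder.1 hz
    have hτ : T + β * z.1 ∈ Ioo (T - δ) T := by
      constructor
      · have : β ≤ δ := hβρ.trans hρδ
        nlinarith [hs.1]
      · nlinarith [hs.2]
    have hr := hrate _ hτ (x₀ + R • z.2)
    have hsq : Real.sqrt (T - (T + β * z.1)) = Real.sqrt β * Real.sqrt (-z.1) := by
      rw [show T - (T + β * z.1) = β * (-z.1) by ring, Real.sqrt_mul hβpos.le]
    rw [hsq] at hr
    have hsβ : 0 < Real.sqrt β := Real.sqrt_pos.2 hβpos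
    rw [smul_stPull_apply, norm_smul, Real.norm_of_nonneg hαpos.le]
    calc Real.sqrt (-z.1) * (α * ‖u (T + β * z.1) (x₀ + R • z.2)‖)
        = α / Real.sqrt β * (Real.sqrt β * Real.sqrt (-z.1) * ‖u (T + β * z.1) (x₀ + R • z.2)‖) := by
          field_simp
      _ ≤ α / Real.sqrt β * C := mul_le_mul_of_nonneg_left hr (by positivity)
  -- the local hypothesis: essential boundedness near the vertex
  obtain ⟨r, hr, hbd⟩ := hloc _ _ hdist hL3 hL32 htypeI
  -- an a.e. bound for `u ∘ Φ` on `Q_r(0)`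
  set S' : Set (ℝ × (EuclideanSpace ℝ (Fin 3))) := parabolicCylinder r ((0 : ℝ), (0 : (EuclideanSpace ℝ (Fin 3)))) with hS'
  set M : ℝ := (eLpNorm (uncurry (α • stPull β R T x₀ u)) ∞ (volume.restrict S')).toReal with hM
  have haeS' : ∀ᵐ w ∂(volume.restrict S'),
      ‖u (stAffine β R T x₀ w).1 (stAffine β R T x₀ w).2‖ ≤ M / α := by
    have h1 := ae_le_eLpNormEssSup (μ := volume.restrict S') (f := uncurry (α • stPull β R T x₀ u))
    filter_upwards [h1] with w hw
    rw [← eLpNorm_exponent_top] at hw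
    have hw' : ‖uncurry (α • stPull β R T x₀ u) w‖ ≤ M := by
      rw [hM, ← ENNReal.ofReal_le_iff_le_toReal hbd.ne, ofReal_norm]
      exact hw
    rw [le_div_iff₀' hαpos]
    have e : uncurry (α • stPull β R T x₀ u) w =
        α • u (stAffine β R T x₀ w).1 (stAffine β R T x₀ w).2 := by
      obtain ⟨s, y⟩ := w; rfl
    rw [e, norm_smul, Real.norm_of_nonneg hαpos.le] at hw'
    exact hw'
  -- transported to the image `Φ(Q_r(0))`
  have haeP : ∀ᵐ z ∂((volume : Measure (ℝ × (EuclideanSpace ℝ (Fin 3)))).restrict (stAffine β R T x₀ '' S')),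
      ‖u z.1 z.2‖ ≤ M / α := by
    refine ae_restrict_of_ae_restrict_preimage_stAffine hβpos hRpos T x₀
      (P := fun z : ℝ × (EuclideanSpace ℝ (Fin 3)) => ‖u z.1 z.2‖ ≤ M / α) ?_
    rw [preimage_image_eq _ (injective_stAffine hβpos.ne' hRpos.ne' T x₀)]
    exact haeS'
  -- a backward cylinder of `(T, x₀)` inside `Φ(Q_r(0))`
  set r' : ℝ := r * min (Real.sqrt β) R with hr'
  have hmin : 0 < min (Real.sqrt β) R := lt_min (Real.sqrt_pos.2 hβpos) hRpos
  have hr'pos : 0 < r' := mul_pos hr hmin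
  have hUsub : parabolicCylinder r' ((T : ℝ), x₀) ⊆ stAffine β R T x₀ '' S' := by
    rintro ⟨t, x⟩ hz
    rw [mem_parabolicCylinder] at hz
    obtain ⟨⟨ht1, ht2⟩, hx⟩ := hz
    refine ⟨((t - T) / β, R⁻¹ • (x - x₀)), ?_, ?_⟩
    · rw [hS', mem_parabolicCylinder]
      have hr'β : r' ^ 2 ≤ β * r ^ 2 := by
        have h1 : r' ≤ r * Real.sqrt β := mul_le_mul_of_nonneg_left (min_le_left _ _) hr.le
        have h2 : r' ^ 2 ≤ (r * Real.sqrt β) ^ 2 := pow_le_pow_left₀ hr'pos.le h1 2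
        have h3 : (r * Real.sqrt β) ^ 2 = β * r ^ 2 := by
          rw [mul_pow, Real.sq_sqrt hβpos.le]; ring
        exact h2.trans_eq h3
      have hr'R : r' ≤ R * r := by
        have h1 : r' ≤ r * R := mul_le_mul_of_nonneg_left (min_le_right _ _) hr.le
        linarith
      refine ⟨⟨?_, ?_⟩, ?_⟩
      · show (0 : ℝ) - r ^ 2 < (t - T) / β
        rw [lt_div_iff₀ hβpos]
        have : T - r' ^ 2 < t := ht1
        nlinarith
      · show (t - T) / β < 0
        have : t < T := ht2
        exact div_neg_of_neg_of_pos (by linarith) hβpos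
      · show dist (R⁻¹ • (x - x₀)) 0 < r
        rw [dist_zero_right, norm_smul, Real.norm_of_nonneg (inv_nonneg.2 hRpos.le),
          inv_mul_lt_iff₀ hRpos]
        have hx' : dist x x₀ < r' := hx
        rw [dist_eq_norm] at hx'
        linarith
    · rw [stAffine_apply]
      ext1
      · show T + β * ((t - T) / β) = t
        field_simp; ring
      · show x₀ + R • R⁻¹ • (x - x₀) = x
        rw [smul_smul, mul_inv_cancel₀ hRpos.ne', one_smul, add_sub_cancel]
  -- the essential bound on that cylinder
  refine ⟨r', hr'pos, ?_⟩
  rw [eLpNorm_exponent_top]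
  refine eLpNormEssSup_lt_top_of_ae_bound (C := M / α) ?_
  have h1 := ae_restrict_of_ae_restrict_of_subset hUsub haeP
  filter_upwards [h1] with z hz
  exact hz

/-- **`NoTypeIBlowup` (item stmt-NavierStokesRegularity-1217) from local Type I regularity.**
If every distributional solution of the unit-viscosity Navier–Stokes system in the unit cylinder
`Q = 𝒞 × ]-1, 0[` with `v ∈ L³(Q)`, `π ∈ L^{3/2}(Q)` and the a.e. Type I rate `√(-s)|v| ≤ C` is
essentially bounded near the vertex (Seregin–Šverák 2009, Thm. 3.1 WITHOUT axial symmetry — an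
OPEN statement, the local core of Type I exclusion; under the Liouville conjecture (L) of
Koch–Nadirashvili–Seregin–Šverák 2009 it would follow by their blow-up argument), then no
classical Leray–Hopf solution from a rapidly decaying datum blows up at the Type I rate: it extends
smoothly past `T`. Proof: every `(T, x₀)` carries a bounded backward cylinder
(`typeI_exists_bounded_parabolicCylinder_of_local`), so `T` is not a blow-up time by
Lemarié-Rieusset 2016, Thm. 15.1 (C) (`hasSmoothExtensionPast_of_forall_exists_parabolicCylinder`).
CONDITIONAL on the hypothesis `hloc`; it does not close the item. [cite: SereginSverak2009, Thm 3.1 (shape of the local statement); LemarieRieusset2016, Thm 15.1 (C)] -/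
theorem noTypeIBlowup_of_local_typeI_regularity
    (hloc : ∀ (v : ℝ → EuclideanSpace ℝ (Fin 3) → EuclideanSpace ℝ (Fin 3))
      (π : ℝ → EuclideanSpace ℝ (Fin 3) → ℝ),
      IsDistributionalNSSolutionOn ssCylinderOpens 1 0 v π →
      (∫⁻ z in ssCylinder, ‖v z.1 z.2‖ₑ ^ (3 : ℕ) < ∞) →
      (∫⁻ z in ssCylinder, ‖π z.1 z.2‖ₑ ^ (3 / 2 : ℝ) < ∞) →
      (∃ C : ℝ, ∀ᵐ z ∂(volume.restrict ssCylinder), Real.sqrt (-z.1) * ‖v z.1 z.2‖ ≤ C) →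
      ∃ r > 0, eLpNorm (uncurry v) ∞ (volume.restrict (parabolicCylinder r ((0 : ℝ), (0 : (EuclideanSpace ℝ (Fin 3)))))) < ∞) :
    Summit.NavierStokesRegularity.NavierStokesRegularity.Theses.TypeICertificateLadder.NoTypeIBlowup := by
  unfold Summit.NavierStokesRegularity.NavierStokesRegularity.Theses.TypeICertificateLadder.NoTypeIBlowup
  intro ν T hν hT u p hcl hLH hdec hI
  exact hasSmoothExtensionPast_of_forall_exists_parabolicCylinder hν hT hcl hLH hdec fun x₀ =>
    let ⟨r, hr, h⟩ := typeI_exists_bounded_parabolicCylinder_of_local hloc hν hT hcl hLH hI x₀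
    ⟨r, hr, h⟩

end Summit.NavierStokesRegularity.NavierStokesRegularity.Theorems

end
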